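import Mathlib
import Summits.ResolutionOfSingularities.ResolutionOfSingularities.Theorems.RadicialJungCleanModelsContactChainL7b
import Summits.ResolutionOfSingularities.ResolutionOfSingularities.Theorems.RadicialJungCleanModelsCleanPermissibleSeq
import Literature.AlgebraicGeometry.Resolution.RegularBlowup
import Literature.AlgebraicGeometry.Resolution.QuasiExcellentBlowup
import HarnessLib

/-!
# Route `RadicialJung`, crux `CleanModels` (stmt-ResolutionOfSingularities-15917), line `Sketch` rev 35, stub 6 `stub_cleanProp44` (X44c),
# work plan O8 — L7b in the currency of `stub_cleanProp44`

✓ `exists_pointChain_cleanPermissibleAt_of_cleanRegAt` (`…ContactChainL7b.lean`) read on a STAGE of X44c: `S` a regular excellent Noetherian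
integral scheme with `char K(S) = p`, the line of `G₀` clean-regular at every point of `S`, `ρ : X → S` a clean-permissible Cossart–Piltant sequence
(`IsCleanRegularCentreBlowupSeq p ρ I G₀`).  Then `X` is regular (✓ `IsRegularCentreBlowupSeq.isRegular`), quasi-excellent
(✓ `IsRegularCentreBlowupSeq.isQuasiExcellent`) and the line of `ρ^♯ G₀` is clean-regular at every point of `X` (✓ `IsCleanRegularCentreBlowupSeq.cleanRegAt`),
so at every closed point `x₀` (`dim 𝒪_{X,x₀} = 3`) of every regular curve `C₀ ⊆ X` a dominant chain of point blowing ups following `C₀` reaches a point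
where the line is clean-permissible for the strict transform of `C₀`:
`exists_pointChain_cleanPermissibleAt_of_isCleanRegularCentreBlowupSeq`.

Honest framing: OURS; this is item O8 of the X44c work plan (memo `Sketch-memo-4e-cleanPermissible.md` §4) in X44c's own hypotheses — nothing here
proves X44c (O1–O7 remain), resolution in characteristic `p`, or any case of `CleanModels`.
-/

noncomputable section

set_option linter.dupNamespace false -- mandated namespace of this single-conjunct summit

open CategoryTheory AlgebraicGeometry TopologicalSpace IsLocalRing
open Literature.AlgebraicGeometry.Resolution Literature.AlgebraicGeometry.Motives
open Scheme.IdealSheafData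

namespace Summit.ResolutionOfSingularities.ResolutionOfSingularities.Theorems.RadicialJung.CleanModels

/-- **L7b on the stages of X44c.**  See the module docstring. [cite: CossartPiltant2008, Prop. 4.4 (proof, p. 10)] [cite: Piltant2013, §2 Axiom 4]
[cite: CossartJannsenSaito2020, proof of Thm. 6.28, Step 5] -/
theorem exists_pointChain_cleanPermissibleAt_of_isCleanRegularCentreBlowupSeq (p : ℕ) [hp : Fact p.Prime] {S : Scheme.{0}} [IsIntegral S]
    [IsNoetherian S] [CharP S.functionField p] (hS : Scheme.IsRegular S) (hE : Scheme.IsExcellent S) (G₀ : S.functionField)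
    (hG₀ : ∀ s : S, CleanRegAt p (algebraMap (S.presheaf.stalk s) S.functionField) G₀) {I : S.IdealSheafData}
    {X : Scheme.{0}} {ρ : X ⟶ S} [IsIntegral X] [IsNoetherian X] [IsDominant ρ] (hρ : IsCleanRegularCentreBlowupSeq p ρ I G₀)
    {C₀ : Closeds X}
    (hC₀reg : ∀ y ∈ (C₀ : Set X), ∃ c : Fin 2 → X.presheaf.stalk y,
      IsRsopPart c ∧ Ideal.span (Set.range c) = stalkIdeal (vanishingIdeal C₀) y)
    {x₀ : X} (hx₀ : IsClosed ({x₀} : Set X)) (hx₀C : x₀ ∈ (C₀ : Set X)) (hdim₀ : ringKrullDim (X.presheaf.stalk x₀) = 3)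
    [hP : (stalkIdeal (vanishingIdeal C₀) x₀).IsPrime]
    (w : X.presheaf.stalk x₀) (hw : stalkIdeal (vanishingIdeal C₀) x₀ ⊔ Ideal.span {w} = maximalIdeal _) :
    ∃ (X' : Scheme.{0}) (_ : IsIntegral X') (_ : IsLocallyNoetherian X') (σ : X' ⟶ X) (_ : IsDominant σ) (C : Closeds X') (x : X') (n : ℕ),
      IsPointChainAlong σ C₀ C x n ∧ σ x = x₀ ∧ IsClosed ({x} : Set X') ∧
      CleanPermissibleAt p (RatFn.toFunctionField x) (RatFn.functionFieldMap σ (RatFn.functionFieldMap ρ G₀))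
        (stalkIdeal (vanishingIdeal C) x) := by
  have hX : Scheme.IsRegular X := hρ.isRegularCentreBlowupSeq.isRegular hS
  have hXE : Scheme.IsQuasiExcellent X := hρ.isRegularCentreBlowupSeq.isQuasiExcellent hE
  haveI : CharP X.functionField p := charP_of_injective_ringHom (RatFn.functionFieldMap ρ).injective p
  have hclean : CleanRegAt p (RatFn.toFunctionField x₀) (RatFn.functionFieldMap ρ G₀) := hρ.cleanRegAt hp.out inferInstance hG₀ x₀
  exact exists_pointChain_cleanPermissibleAt_of_cleanRegAt hX hXE p hC₀reg hx₀ hx₀C hdim₀ w hw _ hclean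

end Summit.ResolutionOfSingularities.ResolutionOfSingularities.Theorems.RadicialJung.CleanModels

end
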